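import Summits.AtomisticToContinuum.HydrodynamicLimit.Theorems.CollisionIsometryCLTAprioriBoundsVisitLedgerDefs
import Summits.AtomisticToContinuum.HydrodynamicLimit.Theorems.AprioriBounds.Negative.ExpMomentTangent
import Literature.MathematicalPhysics.KineticTheory.CollisionTubePullbackFlight
import HarnessLib

/-!
# `AprioriBounds` (stmt-AtomisticToContinuum-9519), line `visit-ledger-upscattering`: the pathwise tiling

Registered stub `stub_tiling` (stub 5a of the lead's skeleton
`Cruxes/AprioriBounds/Lines/visit_ledger_upscattering.lean`; `--supports` the crux): for `σ > 0`,
every `N`, every hard-sphere flow `Φ` of `N + 1` spheres of diameter `σ (N+1)^{-1/3}` on `𝕋³`,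
every horizon `t > 0`, threshold `K₀` and rate `lam ≥ 0`, the **tiling bound** `TilingBound σ N Φ t
K₀ lam` of the line's vocabulary
(`Theorems/CollisionIsometryCLTAprioriBoundsVisitLedgerDefs.lean`): on every good orbit
`∫₀ᵗ (N+1)⁻¹ Σᵢ e^{λ|vᵢ(s)|²} ds ≤ t · (N+1)⁻¹ Σᵢ e^{λ|vᵢ(0)|²} + e^{λK₀} t + (N+1)⁻¹ L_λ`, with
`L_λ = Σ_{energetic entries (τ,i)} e^{λ E(τ,i)} · sojourn(τ,i)` the energetic ledger.

## Proof

Pure trajectory bookkeeping (GST 2013 §4.1: piecewise free flight, binary elastic collisions,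
right-continuity). Sphere by sphere: between two of its OWN collisions the velocity of sphere `i`
is constant — free flight keeps velocities and a collision of a pair not containing `i` does not
move `vᵢ` (`orbit_apply_eq_of_forall_not_participates` of `CollisionTubePullbackFlight`); the own
collision times `ownColl i` are collision times, hence locally finite on good orbits. The abstract
core `integral_exp_step_le` is an induction on the number of own collisions in `(a, t]`: with
`b = ` the capped next own collision after `a` (the `sInf` of the definition of `sojourn`, shown to
be a least element, `isLeast_sInf_union`), `∫_{[a,t]} = e^{λE(a)} (b - a) + ∫_{[b,t]}`, and the
entry at `b` is either energetic (it joins the ledger) or thermal (`e^{λE(b)} ≤ e^{λK₀}`, its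
flight is absorbed in `e^{λK₀} (t - b)`). Summing over `i`, exchanging the finite sum with the
Bochner integral (each summand is measurable in time, `IsHardSphereTrajectory.measurable_torus`,
and bounded by `e^{2λ E(z)}`, energy conservation) and regrouping the per-sphere ledgers into the
`finsum` over `entrySet` (`finsum_mem_iUnion`) gives the bound. No regularity of the geometry and
no smallness of `σ` is used (`0 < σ` is not needed at all).
-/

noncomputable section

open MeasureTheory Filter Set Topology
open scoped ENNReal BigOperators

namespace Summit.AtomisticToContinuum.HydrodynamicLimit.Theorems.VisitLedgerUpscattering

open Literature.MathematicalPhysics.KineticTheory Literature.Analysis.FluidPDE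

/-! ## The abstract core: a right-continuous step function along a locally finite set of jumps -/

/-- For a set of reals `S` finite on bounded intervals, the set `(S ∩ (a, ∞)) ∪ {t}` (the set
whose infimum, capped at `t`, defines `sojourn`) has a least element, namely its infimum. -/
private theorem isLeast_sInf_union {S : Set ℝ} (hS : ∀ a b, (S ∩ Icc a b).Finite) (a t : ℝ) :
    IsLeast ((S ∩ Ioi a) ∪ {t}) (sInf ((S ∩ Ioi a) ∪ {t})) := by
  obtain ⟨m, hm, hmin⟩ := Set.exists_min_image _ id
    (((hS a t).subset (inter_subset_inter_right _ Ioc_subset_Icc_self)).union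
      (finite_singleton t)) ⟨t, Or.inr rfl⟩
  have hmt : m ≤ t := hmin t (Or.inr rfl)
  have hleast : IsLeast ((S ∩ Ioi a) ∪ {t}) m := by
    refine ⟨?_, fun x hx => ?_⟩
    · rcases hm with hm | hm
      · exact Or.inl ⟨hm.1, hm.2.1⟩
      · exact Or.inr hm
    · rcases hx with hx | hx
      · rcases le_or_gt x t with hxt | htx
        · exact hmin x (Or.inl ⟨hx.1, hx.2, hxt⟩)
        · exact hmt.trans htx.le
      · rw [mem_singleton_iff.1 hx]
        exact hmt
  rw [hleast.csInf_eq]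
  exact hleast

/-- The capped next time `b = min (sInf ((S ∩ (a, ∞)) ∪ {t})) t` after `a ≤ t`: `a ≤ b ≤ t`, no
point of `S` lies in `(a, b)`, and if `b < t` then `b` is a point of `S` after `a`. -/
private theorem next_spec {S : Set ℝ} (hS : ∀ a b, (S ∩ Icc a b).Finite) {a t : ℝ} (hat : a ≤ t) :
    a ≤ min (sInf ((S ∩ Ioi a) ∪ {t})) t ∧ min (sInf ((S ∩ Ioi a) ∪ {t})) t ≤ t ∧
      (∀ u ∈ S, a < u → min (sInf ((S ∩ Ioi a) ∪ {t})) t ≤ u) ∧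
      (min (sInf ((S ∩ Ioi a) ∪ {t})) t < t →
        min (sInf ((S ∩ Ioi a) ∪ {t})) t ∈ S ∧ a < min (sInf ((S ∩ Ioi a) ∪ {t})) t) := by
  have hL := isLeast_sInf_union hS a t
  have hle : sInf ((S ∩ Ioi a) ∪ {t}) ≤ t := hL.2 (Or.inr rfl)
  rw [min_eq_left hle]
  refine ⟨?_, hle, fun u hu hau => hL.2 (Or.inl ⟨hu, hau⟩), fun hlt => ?_⟩
  · rcases hL.1 with h | h
    · exact h.2.le
    · rw [mem_singleton_iff.1 h]
      exact hat
  · rcases hL.1 with h | h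
    · exact ⟨h.1, h.2⟩
    · exact absurd (mem_singleton_iff.1 h) hlt.ne

/-- **Flight-by-flight tiling (abstract core).** Let `S ⊆ ℝ` be finite on bounded intervals and
`g : ℝ → ℝ` a function that does not change across intervals `(s₁, s₂]` free of points of `S`
(a right-continuous step function jumping only on `S`), `0 ≤ lam`, `K` a threshold, and
`e^{lam·g}` integrable on `[0, t]`. Then for `0 ≤ a ≤ t` (induction on the number of points of `S` in
`(a, t]`): `∫_{[a,t]} e^{lam g} ≤ e^{lam g(a)} (b - a) + e^{lam K} (t - b) + Σ_{τ ∈ S ∩ (a,t], K ≤ g τ}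
e^{lam g(τ)} · (b_τ - τ)`, where `b = b_a` and `b_τ = min (sInf ((S ∩ (τ, ∞)) ∪ {t})) t` is the capped
next point of `S` after `τ`. -/
private theorem integral_exp_step_le {S : Set ℝ} (hS : ∀ a b, (S ∩ Icc a b).Finite) {t : ℝ}
    {g : ℝ → ℝ} (hg : ∀ s₁ s₂, s₁ ≤ s₂ → (∀ u ∈ Ioc s₁ s₂, u ∉ S) → g s₂ = g s₁) {lam : ℝ}
    (hlam : 0 ≤ lam) (K : ℝ) (hint : IntegrableOn (fun s => Real.exp (lam * g s)) (Icc 0 t)) :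
    ∀ (n : ℕ) (a : ℝ), 0 ≤ a → a ≤ t → (S ∩ Ioc a t).ncard < n →
      ∫ s in Icc a t, Real.exp (lam * g s) ≤
        Real.exp (lam * g a) * (min (sInf ((S ∩ Ioi a) ∪ {t})) t - a) +
          Real.exp (lam * K) * (t - min (sInf ((S ∩ Ioi a) ∪ {t})) t) +
          ∑ᶠ τ ∈ {τ | τ ∈ S ∩ Ioc a t ∧ K ≤ g τ},
            Real.exp (lam * g τ) * (min (sInf ((S ∩ Ioi τ) ∪ {t})) t - τ) := by
  -- nonnegativity of the ledger terms
  have hnonneg : ∀ a', 0 ≤ ∑ᶠ τ ∈ {τ | τ ∈ S ∩ Ioc a' t ∧ K ≤ g τ},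
      Real.exp (lam * g τ) * (min (sInf ((S ∩ Ioi τ) ∪ {t})) t - τ) := fun a' =>
    finsum_mem_induction (fun x : ℝ => 0 ≤ x) le_rfl (fun _ _ => add_nonneg)
      fun τ hτ => mul_nonneg (Real.exp_pos _).le (sub_nonneg.2 (next_spec hS hτ.1.2.2).1)
  intro n
  induction n with
  | zero =>
    intro a _ _ h
    exact absurd h (Nat.not_lt_zero _)
  | succ n ih =>
    intro a h0a hat hcard
    obtain ⟨hab, hbt, hbS, hblt⟩ := next_spec hS hat
    set b := min (sInf ((S ∩ Ioi a) ∪ {t})) t with hb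
    -- the integrand is constant on `[a, b)`
    have hconst : ∀ s ∈ Ico a b, Real.exp (lam * g s) = Real.exp (lam * g a) := by
      intro s hs
      rw [hg a s hs.1 fun u hu huS => (not_le.2 (hu.2.trans_lt hs.2)) (hbS u huS hu.1)]
    have hIab : ∫ s in Icc a b, Real.exp (lam * g s) = Real.exp (lam * g a) * (b - a) := by
      rw [integral_Icc_eq_integral_Ico, setIntegral_congr_fun measurableSet_Ico hconst,
        setIntegral_const, smul_eq_mul, Real.volume_real_Ico_of_le hab, mul_comm]
    rcases hbt.lt_or_eq with hblt' | hbeq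
    · -- `b < t`: `b` is a point of `S`; split at `b` and use the induction hypothesis there
      obtain ⟨hbmem, hab'⟩ := hblt hblt'
      have hfin : (S ∩ Ioc a t).Finite :=
        (hS a t).subset (inter_subset_inter_right _ Ioc_subset_Icc_self)
      have hsub : S ∩ Ioc b t ⊂ S ∩ Ioc a t := by
        refine ⟨fun u hu => ⟨hu.1, hab'.trans hu.2.1, hu.2.2⟩, fun hsub => ?_⟩
        exact (lt_irrefl b) (hsub ⟨hbmem, hab', hbt⟩).2.1
      have hcard' : (S ∩ Ioc b t).ncard < n :=
        lt_of_lt_of_le (Set.ncard_lt_ncard hsub hfin) (Nat.lt_succ_iff.1 hcard)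
      have hIH := ih b (h0a.trans hab) hbt hcard'
      obtain ⟨hbb', hb't, -, -⟩ := next_spec hS hbt
      set b' := min (sInf ((S ∩ Ioi b) ∪ {t})) t with hb'
      -- split the integral at `b`
      have hdisj : Disjoint (Icc a b) (Ioc b t) :=
        Set.disjoint_left.2 fun x hx hx' => (not_lt.2 hx.2) hx'.1
      have hsplit : ∫ s in Icc a t, Real.exp (lam * g s) =
          Real.exp (lam * g a) * (b - a) + ∫ s in Icc b t, Real.exp (lam * g s) := by
        rw [← Icc_union_Ioc_eq_Icc hab hbt, setIntegral_union hdisj measurableSet_Ioc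
          (hint.mono_set (Icc_subset_Icc h0a hbt))
          (hint.mono_set (Ioc_subset_Icc_self.trans (Icc_subset_Icc (h0a.trans hab) le_rfl))),
          hIab, integral_Icc_eq_integral_Ioc]
      by_cases hK : K ≤ g b
      · -- energetic entry at `b`: it joins the ledger
        have hE : {τ | τ ∈ S ∩ Ioc a t ∧ K ≤ g τ} = insert b {τ | τ ∈ S ∩ Ioc b t ∧ K ≤ g τ} := by
          ext τ
          simp only [mem_insert_iff, mem_setOf_eq, mem_inter_iff, mem_Ioc]
          constructor
          · rintro ⟨⟨hτS, haτ, hτt⟩, hKτ⟩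
            rcases lt_trichotomy τ b with hlt | heq | hgt
            · exact absurd (hbS τ hτS haτ) (not_le.2 hlt)
            · exact Or.inl heq
            · exact Or.inr ⟨⟨hτS, hgt, hτt⟩, hKτ⟩
          · rintro (heq | ⟨⟨hτS, hbτ, hτt⟩, hKτ⟩)
            · rw [heq]
              exact ⟨⟨hbmem, hab', hbt⟩, hK⟩
            · exact ⟨⟨hτS, hab.trans_lt hbτ, hτt⟩, hKτ⟩
        have hbnot : b ∉ {τ | τ ∈ S ∩ Ioc b t ∧ K ≤ g τ} := fun h => (lt_irrefl b) h.1.2.1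
        have hfinE : {τ | τ ∈ S ∩ Ioc b t ∧ K ≤ g τ}.Finite :=
          (hS b t).subset fun τ hτ => ⟨hτ.1.1, Ioc_subset_Icc_self hτ.1.2⟩
        rw [hE, finsum_mem_insert _ hbnot hfinE, hsplit]
        have h1 : Real.exp (lam * K) * (t - b') ≤ Real.exp (lam * K) * (t - b) :=
          mul_le_mul_of_nonneg_left (by linarith) (Real.exp_pos _).le
        linarith
      · -- thermal entry at `b`: its flight is absorbed in `e^{lam K} (t - b)`
        have hE : {τ | τ ∈ S ∩ Ioc a t ∧ K ≤ g τ} = {τ | τ ∈ S ∩ Ioc b t ∧ K ≤ g τ} := by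
          ext τ
          simp only [mem_setOf_eq, mem_inter_iff, mem_Ioc]
          constructor
          · rintro ⟨⟨hτS, haτ, hτt⟩, hKτ⟩
            refine ⟨⟨hτS, ?_, hτt⟩, hKτ⟩
            rcases lt_trichotomy τ b with hlt | heq | hgt
            · exact absurd (hbS τ hτS haτ) (not_le.2 hlt)
            · rw [heq] at hKτ
              exact absurd hKτ hK
            · exact hgt
          · rintro ⟨⟨hτS, hbτ, hτt⟩, hKτ⟩
            exact ⟨⟨hτS, hab.trans_lt hbτ, hτt⟩, hKτ⟩
        rw [hE, hsplit]
        have hexp : Real.exp (lam * g b) ≤ Real.exp (lam * K) :=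
          Real.exp_le_exp.2 (mul_le_mul_of_nonneg_left (not_le.1 hK).le hlam)
        have h1 : Real.exp (lam * g b) * (b' - b) ≤ Real.exp (lam * K) * (b' - b) :=
          mul_le_mul_of_nonneg_right hexp (sub_nonneg.2 hbb')
        have h2 : Real.exp (lam * K) * (b' - b) + Real.exp (lam * K) * (t - b') =
            Real.exp (lam * K) * (t - b) := by ring
        linarith
    · -- `b = t`: the flight starting at `a` covers `[a, t]`
      rw [hbeq] at hIab ⊢
      rw [hIab, sub_self, mul_zero, add_zero]
      linarith [hnonneg a]

/-- The abstract core at `a = 0`: `∫_{[0,t]} e^{lam g} ≤ t e^{lam g(0)} + e^{lam K} t +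
Σ_{τ ∈ S ∩ (0,t], K ≤ g τ} e^{lam g(τ)} (b_τ - τ)`. -/
private theorem integral_exp_step_le_zero {S : Set ℝ} (hS : ∀ a b, (S ∩ Icc a b).Finite) {t : ℝ}
    (ht : 0 ≤ t) {g : ℝ → ℝ} (hg : ∀ s₁ s₂, s₁ ≤ s₂ → (∀ u ∈ Ioc s₁ s₂, u ∉ S) → g s₂ = g s₁)
    {lam : ℝ} (hlam : 0 ≤ lam) (K : ℝ)
    (hint : IntegrableOn (fun s => Real.exp (lam * g s)) (Icc 0 t)) :
    ∫ s in Icc 0 t, Real.exp (lam * g s) ≤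
      t * Real.exp (lam * g 0) + Real.exp (lam * K) * t +
        ∑ᶠ τ ∈ {τ | τ ∈ S ∩ Ioc 0 t ∧ K ≤ g τ},
          Real.exp (lam * g τ) * (min (sInf ((S ∩ Ioi τ) ∪ {t})) t - τ) := by
  have h := integral_exp_step_le hS hg hlam K hint ((S ∩ Ioc 0 t).ncard + 1) 0 le_rfl ht
    (Nat.lt_succ_self _)
  obtain ⟨h0b, hbt, -, -⟩ := next_spec hS ht
  set b := min (sInf ((S ∩ Ioi 0) ∪ {t})) t with hb
  have h1 : Real.exp (lam * g 0) * (b - 0) ≤ t * Real.exp (lam * g 0) := by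
    rw [sub_zero, mul_comm]
    exact mul_le_mul_of_nonneg_right hbt (Real.exp_pos _).le
  have h2 : Real.exp (lam * K) * (t - b) ≤ Real.exp (lam * K) * t :=
    mul_le_mul_of_nonneg_left (by linarith) (Real.exp_pos _).le
  linarith

/-! ## Own collisions along a good orbit -/

/-- Own-collision times of sphere `i` are collision times of the orbit. -/
private theorem ownColl_subset_collisionTimes (σ : ℝ) (N : ℕ) (Φ : Flow σ N) (z : Cfg N)
    (i : Fin (N + 1)) :
    ownColl σ N Φ z i ⊆
      collisionTimes (Torus.geometry (Fin 3)) (hsDiameter σ N) (fun s => Φ.flow s z) := by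
  rintro τ ⟨j, hji, h | h⟩
  · exact ⟨i, j, fun hij => hji hij.symm, h⟩
  · exact ⟨j, i, hji, h⟩

/-- On a good orbit the own-collision times of a sphere are finite on bounded intervals. -/
private theorem ownColl_locFinite {σ : ℝ} {N : ℕ} {Φ : Flow σ N} {z : Cfg N} (hz : z ∈ Φ.good)
    (i : Fin (N + 1)) (a b : ℝ) : (ownColl σ N Φ z i ∩ Icc a b).Finite :=
  ((Φ.isTrajectory z hz).locFinite a b).subset
    (inter_subset_inter_left _ (ownColl_subset_collisionTimes σ N Φ z i))

/-- A sphere that participates in a collision at time `τ` has `τ` among its own-collision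
times. -/
private theorem mem_ownColl_of_participates {σ : ℝ} {N : ℕ} {Φ : Flow σ N} {z : Cfg N}
    {i : Fin (N + 1)} {τ : ℝ}
    (h : Participates (Torus.geometry (Fin 3)) (hsDiameter σ N) (Φ.flow τ z) i) :
    τ ∈ ownColl σ N Φ z i := by
  obtain ⟨j, h | h⟩ := h
  · obtain ⟨hij, hc⟩ := mem_contactPairs.1 h
    exact ⟨j, fun hji => hij hji.symm, Or.inl hc⟩
  · obtain ⟨hji, hc⟩ := mem_contactPairs.1 h
    exact ⟨j, hji, Or.inr hc⟩

/-- **Between two of its own collisions a sphere keeps its velocity**: if sphere `i` has no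
own collision in `(s₁, s₂]`, its outgoing energy at `s₂` is that at `s₁` (free flight keeps
velocities, collisions of other pairs do not move `vᵢ`; `orbit_apply_eq_of_forall_not_participates`). -/
private theorem postE_eq_of_forall_notMem {σ : ℝ} {N : ℕ} {Φ : Flow σ N} {z : Cfg N}
    (hz : z ∈ Φ.good) (i : Fin (N + 1)) {s₁ s₂ : ℝ} (h12 : s₁ ≤ s₂)
    (hfree : ∀ u ∈ Ioc s₁ s₂, u ∉ ownColl σ N Φ z i) :
    postE σ N Φ z s₂ i = postE σ N Φ z s₁ i := by
  have h := orbit_apply_eq_of_forall_not_participates hz i h12 fun u hu hpart =>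
    hfree u hu (mem_ownColl_of_participates hpart)
  have h2 := congrArg Prod.snd h
  simp only [orbit_apply] at h2
  rw [postE, postE, h2]

/-- Along a good orbit `s ↦ e^{lam |vᵢ(s)|²}` is integrable on bounded intervals (measurable in
time and bounded by `e^{2 lam E(z)}`, conservation of energy), for `0 ≤ lam`. -/
private theorem integrableOn_exp_postE {σ : ℝ} {N : ℕ} {Φ : Flow σ N} {z : Cfg N}
    (hz : z ∈ Φ.good) (i : Fin (N + 1)) {lam : ℝ} (hlam : 0 ≤ lam) (a b : ℝ) :
    IntegrableOn (fun s => Real.exp (lam * postE σ N Φ z s i)) (Icc a b) := by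
  have hγm : Measurable fun s => Φ.flow s z := (Φ.isTrajectory z hz).measurable_torus
  have hFw : Measurable fun w : Cfg N => Real.exp (lam * ‖(w i).2‖ ^ 2) := by fun_prop
  have hFm : Measurable fun s => Real.exp (lam * postE σ N Φ z s i) := hFw.comp hγm
  have hbound : ∀ s, Real.exp (lam * postE σ N Φ z s i) ≤
      Real.exp (lam * (2 * configEnergy z)) := fun s => by
    refine Real.exp_le_exp.2 (mul_le_mul_of_nonneg_left ?_ hlam)
    have h := norm_vel_sq_le_two_mul_configEnergy (Φ.flow s z) i
    rwa [AprioriBoundsNegative.configEnergy_flow_of_mem_good Φ hz s] at h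
  haveI : IsFiniteMeasure (volume.restrict (Icc a b)) := by infer_instance
  exact Integrable.of_bound hFm.aestronglyMeasurable _ (Eventually.of_forall fun s => by
    rw [Real.norm_eq_abs, abs_of_nonneg (Real.exp_pos _).le]
    exact hbound s)

/-- **Per-sphere tiling**: on a good orbit, for `0 ≤ t`, `0 ≤ lam` and every sphere `i`,
`∫_{[0,t]} e^{lam |vᵢ(s)|²} ds ≤ t e^{lam |vᵢ(0)|²} + e^{lam K₀} t + Σ_{own entries τ of i in (0,t],
E ≥ K₀} e^{lam E(τ,i)} · sojourn(τ,i)`. -/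
private theorem sphere_tiling {σ : ℝ} {N : ℕ} {Φ : Flow σ N} {z : Cfg N} (hz : z ∈ Φ.good)
    {t : ℝ} (ht : 0 ≤ t) (K₀ : ℕ) {lam : ℝ} (hlam : 0 ≤ lam) (i : Fin (N + 1)) :
    ∫ s in Icc 0 t, Real.exp (lam * postE σ N Φ z s i) ≤
      t * Real.exp (lam * postE σ N Φ z 0 i) + Real.exp (lam * K₀) * t +
        ∑ᶠ τ ∈ {τ | τ ∈ ownColl σ N Φ z i ∩ Ioc 0 t ∧ (K₀ : ℝ) ≤ postE σ N Φ z τ i},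
          Real.exp (lam * postE σ N Φ z τ i) * sojourn σ N Φ z t τ i :=
  integral_exp_step_le_zero (ownColl_locFinite hz i) ht
    (fun _ _ h12 hfree => postE_eq_of_forall_notMem hz i h12 hfree) hlam (K₀ : ℝ)
    (integrableOn_exp_postE hz i hlam 0 t)

/-- **The per-sphere ledgers add up to the energetic ledger**: the energetic entries are the
disjoint union over `i` of the energetic own entries of sphere `i`. -/
private theorem sum_sphere_ledger_eq {σ : ℝ} {N : ℕ} {Φ : Flow σ N} {z : Cfg N} (hz : z ∈ Φ.good)
    (t : ℝ) (K₀ : ℕ) (lam : ℝ) :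
    ∑ i, ∑ᶠ τ ∈ {τ | τ ∈ ownColl σ N Φ z i ∩ Ioc 0 t ∧ (K₀ : ℝ) ≤ postE σ N Φ z τ i},
        Real.exp (lam * postE σ N Φ z τ i) * sojourn σ N Φ z t τ i =
      energeticLedger σ N Φ z t K₀ lam := by
  have hU : entrySet σ N Φ z t K₀ = ⋃ i : Fin (N + 1), (fun τ : ℝ => (τ, i)) ''
      {τ | τ ∈ ownColl σ N Φ z i ∩ Ioc 0 t ∧ (K₀ : ℝ) ≤ postE σ N Φ z τ i} := by
    ext p
    simp only [entrySet, mem_setOf_eq, mem_iUnion, mem_image]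
    constructor
    · intro hp
      exact ⟨p.2, p.1, hp, rfl⟩
    · rintro ⟨i, τ, hτ, rfl⟩
      exact hτ
  have hfin : ∀ i : Fin (N + 1),
      {τ | τ ∈ ownColl σ N Φ z i ∩ Ioc 0 t ∧ (K₀ : ℝ) ≤ postE σ N Φ z τ i}.Finite := fun i =>
    (ownColl_locFinite hz i 0 t).subset fun τ hτ => ⟨hτ.1.1, Ioc_subset_Icc_self hτ.1.2⟩
  have hdisj : Pairwise (Function.onFun Disjoint fun i : Fin (N + 1) => (fun τ : ℝ => (τ, i)) ''
      {τ | τ ∈ ownColl σ N Φ z i ∩ Ioc 0 t ∧ (K₀ : ℝ) ≤ postE σ N Φ z τ i}) := by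
    intro i j hij
    refine Set.disjoint_left.2 ?_
    rintro p ⟨τ, -, rfl⟩ ⟨τ', -, h⟩
    exact hij (Prod.mk.inj h).2.symm
  rw [energeticLedger, hU, finsum_mem_iUnion hdisj (fun i => (hfin i).image _),
    ← finsum_eq_sum_of_fintype]
  refine finsum_congr fun i => ?_
  rw [finsum_mem_image fun τ _ τ' _ h => (Prod.mk.inj h).1]

/-! ## The registered stub -/

/-- **STUB 5a — the pathwise tiling** (`TilingBound`, B2 of the idea card
`visit-ledger-upscattering`): for `σ > 0`, every `N`, every flow `Φ` of `N + 1` spheres, every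
horizon `t > 0`, threshold `K₀` and rate `lam ≥ 0`, on every GOOD orbit
`∫₀ᵗ (N+1)⁻¹Σᵢ e^{λ|vᵢ(s)|²} ds ≤ t·(N+1)⁻¹Σᵢ e^{λ|vᵢ(0)|²} + e^{λK₀} t + (N+1)⁻¹ L_λ`. Between two of
its own collisions a sphere's velocity is constant, so the flights of each sphere tile `[0,t]`:
initial flights are priced by the time-zero moment, thermal entries (`E < K₀`) by `e^{λK₀}` times
their total flight length `≤ t`, and energetic entries by the ledger. -/
theorem stub_tiling :
    ∀ σ : ℝ, 0 < σ → ∀ (N : ℕ) (Φ : Flow σ N) (t : ℝ), 0 < t → ∀ (K₀ : ℕ) (lam : ℝ), 0 ≤ lam →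
      TilingBound σ N Φ t K₀ lam := by
  intro σ _ N Φ t ht K₀ lam hlam z hz
  have hF : ∀ s, ∫ y, Real.exp (lam * ‖y.2‖ ^ 2) ∂(empiricalMeasure (Φ.flow s z)) =
      ((N + 1 : ℕ) : ℝ)⁻¹ * ∑ i, Real.exp (lam * postE σ N Φ z s i) := fun s =>
    AprioriBoundsNegative.integral_expMoment_empiricalMeasure lam (Φ.flow s z)
  have hF0 : ∫ y, Real.exp (lam * ‖y.2‖ ^ 2) ∂(empiricalMeasure z) =
      ((N + 1 : ℕ) : ℝ)⁻¹ * ∑ i, Real.exp (lam * postE σ N Φ z 0 i) := by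
    rw [AprioriBoundsNegative.integral_expMoment_empiricalMeasure]
    simp only [postE, Φ.flow_zero z hz]
  simp_rw [hF]
  rw [hF0, integral_const_mul,
    integral_finsetSum _ fun i _ => integrableOn_exp_postE hz i hlam 0 t]
  have hsum : ∑ i, ∫ s in Icc 0 t, Real.exp (lam * postE σ N Φ z s i) ≤
      ∑ i : Fin (N + 1), (t * Real.exp (lam * postE σ N Φ z 0 i) + Real.exp (lam * K₀) * t +
        ∑ᶠ τ ∈ {τ | τ ∈ ownColl σ N Φ z i ∩ Ioc 0 t ∧ (K₀ : ℝ) ≤ postE σ N Φ z τ i},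
          Real.exp (lam * postE σ N Φ z τ i) * sojourn σ N Φ z t τ i) :=
    Finset.sum_le_sum fun i _ => sphere_tiling hz ht.le K₀ hlam i
  have hN : ((N + 1 : ℕ) : ℝ) ≠ 0 := by positivity
  have hc0 : 0 ≤ ((N + 1 : ℕ) : ℝ)⁻¹ := by positivity
  have hc1 : ((N + 1 : ℕ) : ℝ)⁻¹ * (((N + 1 : ℕ) : ℝ) * (Real.exp (lam * K₀) * t)) =
      Real.exp (lam * K₀) * t := by
    rw [← mul_assoc, inv_mul_cancel₀ hN, one_mul]
  calc ((N + 1 : ℕ) : ℝ)⁻¹ * ∑ i, ∫ s in Icc 0 t, Real.exp (lam * postE σ N Φ z s i)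
      ≤ ((N + 1 : ℕ) : ℝ)⁻¹ * ∑ i : Fin (N + 1), (t * Real.exp (lam * postE σ N Φ z 0 i) +
          Real.exp (lam * K₀) * t +
          ∑ᶠ τ ∈ {τ | τ ∈ ownColl σ N Φ z i ∩ Ioc 0 t ∧ (K₀ : ℝ) ≤ postE σ N Φ z τ i},
            Real.exp (lam * postE σ N Φ z τ i) * sojourn σ N Φ z t τ i) :=
        mul_le_mul_of_nonneg_left hsum hc0
    _ = t * (((N + 1 : ℕ) : ℝ)⁻¹ * ∑ i, Real.exp (lam * postE σ N Φ z 0 i)) +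
          Real.exp (lam * K₀) * t +
          ((N + 1 : ℕ) : ℝ)⁻¹ * energeticLedger σ N Φ z t K₀ lam := by
        rw [Finset.sum_add_distrib, Finset.sum_add_distrib, Finset.sum_const, Finset.card_univ,
          Fintype.card_fin, nsmul_eq_mul, ← Finset.mul_sum, sum_sphere_ledger_eq hz t K₀ lam,
          mul_add, mul_add, hc1]
        ring

end Summit.AtomisticToContinuum.HydrodynamicLimit.Theorems.VisitLedgerUpscattering

end
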